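import Summits.PneNP.PneNP.Theorems.SymmetryBudgetRigidBenchmarkEquivalence
import Summits.PneNP.PneNP.Theorems.NPNotSubsetPPoly
import Literature.Computability.Complexity.GraphMatrixCircuits
import Literature.Computability.Complexity.ThreeColourability
import Literature.Computability.Complexity.PPolyReductions

/-!
# Calibration of `SymmetryBudget.RigidBenchmark` (item stmt-PneNP-2149), VI:
# `RigidBenchmark ↔ NPNotSubsetPPoly`

`SymmetryBudgetRigidBenchmarkEquivalence.lean` identifies the route's rigid-instance benchmark with
the PLAIN circuit lower bound for 3-colourability on matrix inputs
(`rigidBenchmark_iff_threeColHardIO`, `not_rigidBenchmark_iff_eventually_threeColPolySize`), and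
`SymmetryBudgetRigidBenchmarkNPBridge.lean` derives `RigidBenchmark → NPNotSubsetPPoly`. This file
closes the circle with the tree's conjecture leaf `NPNotSubsetPPoly = ¬ (NP ⊆ P/poly)`
(`Theorems/NPNotSubsetPPoly.lean`):

* `threeCOL_mem_PPoly_iff_eventually_threeColPolySize` — the string language `THREECOL`
  (`ThreeColourability.lean`) is in `P/poly` iff, for some polynomial `q`, eventually in `n` some
  `tcBasis`-circuit of size `≤ q n` computes 3-colourability of `Gr x` on all `n × n` matrices `x`
  (representation independence, `GraphMatrix.mem_PPoly_iff_eventually_polySize`);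
* `not_rigidBenchmark_iff_threeCOL_mem_PPoly` — hence `¬ RigidBenchmark ↔ THREECOL ∈ P/poly`;
* `rigidBenchmark_iff_npNotSubsetPPoly_of` — and, GIVEN the NP-completeness of `THREECOL`
  (`IsNPComplete THREECOL`, proved in `ThreeColouringMachine.lean`; taken here as a hypothesis so
  that this file does not depend on that module), **`RigidBenchmark ↔ NPNotSubsetPPoly`**
  (`P/poly` is closed under Karp reductions, `NP_subset_PPoly_iff_of_isNPComplete`).

So the item is, letter for letter up to a kernel-checked equivalence, the summit's own open
circuit-lower-bound conjecture `NP ⊄ P/poly`: it can be neither proved nor refuted short of settling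
that conjecture.
-/

-- `Summit.PneNP.PneNP.…` duplicates `PneNP` BY DESIGN (single-problem summit, D-0017); the Summits
-- library sets this option globally (lakefile), repeated here so a standalone `lean check` is warning-free.
set_option linter.dupNamespace false

namespace Summit.PneNP.PneNP.Theorems

open Literature.Computability.Complexity _root_.Computability Filter Polynomial
open Summit.PneNP.PneNP.Theses.SymmetryBudget (RigidBenchmark)
open scoped Classical

/-- The slice of `threeColSet` at `m` vertices is 3-colourability of the matrix graph `Gr x`. -/
theorem sliceFn_threeColSet (m : ℕ) (x : Fin m × Fin m → Bool) :
    GraphMatrix.sliceFn threeColSet m x =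
      decide ((SimpleGraph.fromRel fun u v => x (u, v) = true : SimpleGraph (Fin m)).Colorable 3) := by
  unfold GraphMatrix.sliceFn
  exact decide_eq_decide.2 (mem_threeColSet_iff _)

/-- **`THREECOL ∈ P/poly` iff 3-colourability of `Gr x` eventually has polynomial-size matrix-input
`tcBasis`-circuits** (representation independence of `P/poly` for graph properties,
`GraphMatrix.mem_PPoly_iff_eventually_polySize`, specialised to `threeColSet`). -/
theorem threeCOL_mem_PPoly_iff_eventually_threeColPolySize :
    THREECOL ∈ PPoly ↔ ∃ q : Polynomial ℕ, ∀ᶠ n in atTop, ∃ D : Circuit (Fin n × Fin n), D.IsOver tcBasis ∧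
      D.size ≤ q.eval n ∧ ∀ x : Fin n × Fin n → Bool,
        D.eval x = decide ((SimpleGraph.fromRel fun u v => x (u, v) = true :
          SimpleGraph (Fin n)).Colorable 3) := by
  unfold THREECOL
  rw [GraphMatrix.mem_PPoly_iff_eventually_polySize]
  simp only [Circuit.Computes, sliceFn_threeColSet]

/-- **`¬ RigidBenchmark ↔ THREECOL ∈ P/poly`**: the benchmark fails exactly when GRAPH
3-COLOURABILITY has polynomial-size circuit families. -/
theorem not_rigidBenchmark_iff_threeCOL_mem_PPoly : ¬ RigidBenchmark ↔ THREECOL ∈ PPoly :=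
  not_rigidBenchmark_iff_eventually_threeColPolySize.trans
    threeCOL_mem_PPoly_iff_eventually_threeColPolySize.symm

/-- **`RigidBenchmark ↔ NPNotSubsetPPoly`, given the NP-completeness of `THREECOL`** (`P/poly` is
closed under Karp reductions: `NP ⊆ P/poly ↔ L ∈ P/poly` for NP-complete `L`,
`NP_subset_PPoly_iff_of_isNPComplete`). The hypothesis is discharged by `THREECOL_isNPComplete`
(`ThreeColouringMachine.lean`). -/
theorem rigidBenchmark_iff_npNotSubsetPPoly_of (h3 : IsNPComplete THREECOL) :
    RigidBenchmark ↔ NPNotSubsetPPoly := by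
  unfold NPNotSubsetPPoly
  rw [NP_subset_PPoly_iff_of_isNPComplete h3, ← not_rigidBenchmark_iff_threeCOL_mem_PPoly, not_not]

end Summit.PneNP.PneNP.Theorems
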